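import Literature.Barriers.AnomalousDissipation.ShearFlowViscositySelectionLimit
import Literature.Analysis.FunctionSpaces.SpaceTimeWeakCompactness
import Literature.Analysis.FluidPDE.PassiveScalarProofs
import HarnessLib

/-!
# Bardos–Titi–Wiedemann 2012, Lemma 4 — the shear transport is a weak solution (existence half,
proved)

Companion to `Literature/Barriers/AnomalousDissipation/ShearFlowViscositySelectionLimit.lean`,
whose named fact `BardosTitiWiedemann2012_lemma4` (Bardos–Titi–Wiedemann, C. R. Math. 350
(2012), Lemma 4: for `v ∈ L²(T)`, `w₀ ∈ L²(T²)` the Cauchy problem `∂ₜw + v(x₂)∂₁w = 0`,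
`w(0) = w₀` "has a solution `w ∈ C([0,T];L²_w(T²))`, satisfying the equation in the sense of
distributions, and this solution is unique in the class `L^∞((0,T);L²(T²))`"; "We omit the
elementary proof") has two conjuncts. This theorem-only file **proves the first (existence)
conjunct** with the explicit solution `shearTransport v w₀ t x = w₀(x₁ - t v(x₂), x₂)`
(Bardos–Titi 2010, Thm. 2, the shear flow as a weak solution):

* skew translations `x ↦ (x₁ + f(x₂), x₂)` of `T²` preserve Haar measure and are measurable
  equivalences (`measurePreserving_skew`, `exists_measurableEquiv_skew`; Fubini and translation
  invariance, Mathlib's `MeasurePreserving.skew_product`), whence the slice energies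
  `∫ |w(t)|² = ∫ |w₀|²` and the change of variables `integral_shearTransport_mul`;
* along the characteristics, `d/dt ψ(t, (y₁ + t c, y₂)) = (∂ₜψ + c ∂₁ψ)(t, ·)`
  (`hasDerivAt_test_comp_skew`, chain rule through the space–time lift), so
  `∫₀ᵀ (∂ₜψ + c∂₁ψ) dt = -ψ(0,y)` for tests vanishing near `T` (`setIntegral_deriv_test_comp_skew`);
* the weak identity `∫₀ᵀ∫ w (∂ₜψ + (v,0)·∇ψ) + ∫ w₀ψ(0) = 0` (`shearTransport_weak_eq`: slice
  change of variables, Fubini, fundamental theorem of calculus), and all other clauses of the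
  accepted `Torus.IsWeakScalarTransportOn T 0 (shearVelocity v) w₀` — measurability through the
  measure-preserving space–time skew map, the `L^∞_t L²_x` bound, `u ∈ L¹_t L²_x`, `uw ∈ L¹`
  (Cauchy–Schwarz), weak incompressibility of `(v(x₂),0)` — first for a measurable `v`
  (`isWeakScalarTransportOn_shearTransport_of_measurable`), then for every `v ∈ L²` by a
  null-set change (`isWeakScalarTransportOn_shearTransport`);
* weak continuity `t ↦ ∫ w(t) g` for `g ∈ L²` (`continuous_integral_shearTransport_mul`:
  dominated convergence for continuous `g`, density and the uniform bound `‖w₀‖₂‖g - g̃‖₂`);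
* `BardosTitiWiedemann2012_lemma4_exists` — the existence conjunct of the named fact, verbatim.

The uniqueness conjunct is the subject of a sibling file.

## References

* C. Bardos, E. S. Titi, E. Wiedemann, C. R. Math. Acad. Sci. Paris 350 (2012) 757–760, Lemma 4
  (`BardosTitiWiedemann2012`).
* C. Bardos, E. S. Titi, Discrete Contin. Dyn. Syst. Ser. S 3 (2010) 185–197, Thm. 2, Lemma 3
  (`BardosTiti2010`).
-/

open MeasureTheory Set Filter Topology Function UnitAddTorus
open scoped ENNReal NNReal InnerProductSpace RealInnerProductSpace ContDiff

noncomputable section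

namespace Literature.Barriers.AnomalousDissipation

/-- The flat two-torus `T² = (ℝ/ℤ)²` (local notation). -/
local notation "𝕋²" => UnitAddTorus (Fin 2)

/-! ## Skew translations of `T²` -/

section Skew

/-- On `T × T`, the skew translation `(a, b) ↦ (a + f b, b)` by a measurable `f` preserves the
product Haar measure (Fubini and translation invariance; Mathlib's
`MeasurePreserving.skew_product` conjugated by the swap). [folklore] -/
theorem measurePreserving_prod_skew {f : UnitAddCircle → UnitAddCircle} (hf : Measurable f) :
    MeasurePreserving (fun p : UnitAddCircle × UnitAddCircle => (p.1 + f p.2, p.2))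
      ((volume : Measure UnitAddCircle).prod volume) ((volume : Measure UnitAddCircle).prod volume) := by
  have hskew : MeasurePreserving (fun p : UnitAddCircle × UnitAddCircle => (id p.1, p.2 + f p.1))
      ((volume : Measure UnitAddCircle).prod volume) ((volume : Measure UnitAddCircle).prod volume) :=
    (MeasurePreserving.id _).skew_product (g := fun b a => a + f b)
      (measurable_snd.add (hf.comp measurable_fst))
      (ae_of_all _ fun b => (measurePreserving_add_right volume (f b)).map_eq)
  have : (fun p : UnitAddCircle × UnitAddCircle => (p.1 + f p.2, p.2)) =
      Prod.swap ∘ (fun p : UnitAddCircle × UnitAddCircle => (id p.1, p.2 + f p.1)) ∘ Prod.swap := rfl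
  rw [this]
  exact Measure.measurePreserving_swap.comp (hskew.comp Measure.measurePreserving_swap)

/-- `![x 0, x 1] = x` on `T²`. [folklore] -/
theorem vec2_eta (x : 𝕋²) : (![x 0, x 1] : 𝕋²) = x := by
  funext i; fin_cases i <;> rfl

/-- **Skew translations of `T²` preserve Haar measure**: for measurable `f : T → T`,
`x ↦ (x₁ + f(x₂), x₂)` is measure preserving on `T²` (transport of `measurePreserving_prod_skew`
along `MeasurableEquiv.finTwoArrow`). [folklore] -/
theorem measurePreserving_skew {f : UnitAddCircle → UnitAddCircle} (hf : Measurable f) :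
    MeasurePreserving (fun x : 𝕋² => (![x 0 + f (x 1), x 1] : 𝕋²)) volume volume := by
  have he := volume_preserving_finTwoArrow UnitAddCircle
  have h := (he.symm.comp (measurePreserving_prod_skew hf)).comp he
  convert h using 1
  funext x
  simp only [Function.comp_apply, MeasurableEquiv.finTwoArrow_apply]
  apply (MeasurableEquiv.finTwoArrow).injective
  rw [MeasurableEquiv.apply_symm_apply]
  simp [MeasurableEquiv.finTwoArrow_apply]

/-- **The skew translation as a measure-preserving measurable equivalence** (for changes of
variables): for measurable `f : T → T` there is `e : T² ≃ᵐ T²` with `e x = (x₁ + f x₂, x₂)`,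
`e⁻¹ x = (x₁ - f x₂, x₂)`, preserving Haar measure. [folklore] -/
theorem exists_measurableEquiv_skew {f : UnitAddCircle → UnitAddCircle} (hf : Measurable f) :
    ∃ e : 𝕋² ≃ᵐ 𝕋², (∀ x, e x = ![x 0 + f (x 1), x 1]) ∧ (∀ x, e.symm x = ![x 0 - f (x 1), x 1]) ∧
      MeasurePreserving e volume volume := by
  have hmeas : ∀ g : UnitAddCircle → UnitAddCircle, Measurable g →
      Measurable fun x : 𝕋² => (![x 0 + g (x 1), x 1] : 𝕋²) := fun g hg =>
    measurable_pi_lambda _ fun i => by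
      fin_cases i
      · exact (measurable_pi_apply 0).add (hg.comp (measurable_pi_apply 1))
      · exact measurable_pi_apply 1
  refine ⟨{ toFun := fun x => ![x 0 + f (x 1), x 1]
            invFun := fun x => ![x 0 - f (x 1), x 1]
            left_inv := fun x => ?_
            right_inv := fun x => ?_
            measurable_toFun := hmeas f hf
            measurable_invFun := by
              simpa [sub_eq_add_neg] using hmeas (fun s => -f s) hf.neg },
    fun x => rfl, fun x => rfl, measurePreserving_skew hf⟩
  · funext i; fin_cases i <;> simp
  · funext i; fin_cases i <;> simp

end Skew

/-! ## Slices of the shear transport -/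

section Slices

variable {v : UnitAddCircle → ℝ} {w₀ : 𝕋² → ℝ}

/-- The shear transport at time `t` is the datum composed with the skew translation by
`-t v`. [folklore] -/
theorem shearTransport_eq_comp (v : UnitAddCircle → ℝ) (w₀ : 𝕋² → ℝ) (t : ℝ) :
    shearTransport v w₀ t = w₀ ∘ fun x : 𝕋² =>
      (![x 0 + (fun s : UnitAddCircle => -((t * v s : ℝ) : UnitAddCircle)) (x 1), x 1] : 𝕋²) := by
  funext x
  simp [shearTransport, sub_eq_add_neg]

/-- Measurability of `s ↦ ↑(t v s)` and of its negative, for measurable `v`. [folklore] -/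
theorem measurable_coe_mul (hv : Measurable v) (t : ℝ) :
    Measurable (fun s : UnitAddCircle => ((t * v s : ℝ) : UnitAddCircle)) ∧
      Measurable (fun s : UnitAddCircle => -((t * v s : ℝ) : UnitAddCircle)) := by
  have h : Measurable fun s : UnitAddCircle => ((t * v s : ℝ) : UnitAddCircle) :=
    AddCircle.measurable_mk'.comp (measurable_const.mul hv)
  exact ⟨h, h.neg⟩

/-- **Slices of the shear transport are in `L²` with the energy of the datum** (the skew
translation preserves Haar measure; Bardos–Titi 2010, Lemma 3). [cite: BardosTiti2010, Lemma 3] -/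
theorem memLp_shearTransport (hv : Measurable v) (hw₀ : MemLp w₀ 2 volume) (t : ℝ) :
    MemLp (shearTransport v w₀ t) 2 volume := by
  rw [shearTransport_eq_comp]
  exact hw₀.comp_measurePreserving (measurePreserving_skew (measurable_coe_mul hv t).2)

/-- The energy of a slice of the shear transport is that of the datum. [cite: BardosTiti2010, Lemma 3] -/
theorem lintegral_enorm_sq_shearTransport (hv : Measurable v) (w₀ : 𝕋² → ℝ) (t : ℝ) :
    ∫⁻ x, ‖shearTransport v w₀ t x‖ₑ ^ 2 = ∫⁻ x, ‖w₀ x‖ₑ ^ 2 := by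
  obtain ⟨e, he, -, hmp⟩ := exists_measurableEquiv_skew (measurable_coe_mul hv t).2
  have h : shearTransport v w₀ t = (fun x => w₀ x) ∘ e := by
    rw [shearTransport_eq_comp]; funext x; simp [he x]
  rw [h]
  exact hmp.lintegral_comp_emb e.measurableEmbedding (f := fun x => ‖w₀ x‖ₑ ^ 2)

/-- **Change of variables against a slice of the shear transport**:
`∫ w₀(x₁ - t v(x₂), x₂) F(x) dx = ∫ w₀(y) F(y₁ + t v(y₂), y₂) dy`. [folklore] -/
theorem integral_shearTransport_mul (hv : Measurable v) (w₀ F : 𝕋² → ℝ) (t : ℝ) :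
    ∫ x, shearTransport v w₀ t x * F x =
      ∫ y, w₀ y * F ![y 0 + ((t * v (y 1) : ℝ) : UnitAddCircle), y 1] := by
  obtain ⟨e, he, -, hmp⟩ := exists_measurableEquiv_skew (measurable_coe_mul hv t).1
  rw [← hmp.integral_comp' (g := fun x => shearTransport v w₀ t x * F x)]
  refine integral_congr_ae (Eventually.of_forall fun y => ?_)
  simp only [he y, shearTransport]
  congr 2
  funext i; fin_cases i <;> simp

end Slices

/-! ## The test function along the characteristics -/

section Characteristics

variable {T : ℝ} {ψ : ℝ → 𝕋² → ℝ}

/-- A spatial partial derivative of a space–time test function is jointly continuous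
(dot-notation extension of the accepted `Torus.IsSpaceTimeTest`, declared with its absolute
name; sibling of `IsSpaceTimeTest.continuous_uncurry_timeDeriv`). [folklore] -/
theorem _root_.Literature.Analysis.FunctionSpaces.Torus.IsSpaceTimeTest.continuous_uncurry_partialDeriv
    {d : Type*} [Fintype d] [DecidableEq d] {ψ : ℝ → UnitAddTorus d → ℝ}
    (hψ : Literature.Analysis.FunctionSpaces.Torus.IsSpaceTimeTest T ψ) (i : d) :
    Continuous (uncurry fun t => Literature.Analysis.FunctionSpaces.Torus.partialDeriv i (ψ t)) := by
  have h := ((hψ.isSmoothSpaceTimeOn univ).partialDeriv uniqueDiffOn_univ i).continuousOn_stLift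
  rw [univ_prod_univ, continuousOn_univ] at h
  exact Literature.Analysis.FunctionSpaces.Torus.continuous_uncurry_of_continuous_stLift h

/-- The moving point `(y₁ + t c, y₂)` as the projection of an affine curve in `ℝ²`. [folklore] -/
theorem skewPoint_eq_proj (y : 𝕋²) {yl : EuclideanSpace ℝ (Fin 2)}
    (hyl : Literature.Analysis.FunctionSpaces.Torus.proj yl = y) (c τ : ℝ) :
    (![y 0 + ((τ * c : ℝ) : UnitAddCircle), y 1] : 𝕋²) =
      Literature.Analysis.FunctionSpaces.Torus.proj (yl + (τ * c) • EuclideanSpace.single (0 : Fin 2) (1 : ℝ)) := by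
  rw [Literature.Analysis.FunctionSpaces.Torus.proj_add, hyl]
  funext i
  fin_cases i <;> simp [Literature.Analysis.FunctionSpaces.Torus.proj_apply]

/-- **Derivative of a test function along the shear characteristics**: for a smooth
space–time `ψ`, `d/dt ψ(t, (y₁ + t c, y₂)) = ∂ₜψ(t, ·) + c ∂₁ψ(t, ·)` at the moving point
(chain rule through the space–time lift). [folklore] -/
theorem hasDerivAt_test_comp_skew (hψ : Literature.Analysis.FunctionSpaces.Torus.IsSpaceTimeTest T ψ)
    (c : ℝ) (y : 𝕋²) (t : ℝ) :
    HasDerivAt (fun τ => ψ τ ![y 0 + ((τ * c : ℝ) : UnitAddCircle), y 1])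
      (Literature.Analysis.FunctionSpaces.Torus.timeDeriv ψ t ![y 0 + ((t * c : ℝ) : UnitAddCircle), y 1] +
        c * Literature.Analysis.FunctionSpaces.Torus.partialDeriv 0 (ψ t)
          ![y 0 + ((t * c : ℝ) : UnitAddCircle), y 1]) t := by
  obtain ⟨yl, hyl⟩ := Literature.Analysis.FunctionSpaces.Torus.proj_surjective y
  set e₀ : EuclideanSpace ℝ (Fin 2) := EuclideanSpace.single (0 : Fin 2) (1 : ℝ) with he₀
  set Y : EuclideanSpace ℝ (Fin 2) := yl + (t * c) • e₀ with hY
  have hpt := skewPoint_eq_proj y hyl c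
  have hG : (fun τ => ψ τ ![y 0 + ((τ * c : ℝ) : UnitAddCircle), y 1]) =
      fun τ => Literature.Analysis.FunctionSpaces.Torus.stLift ψ (τ, yl + (τ * c) • e₀) := by
    funext τ; rw [hpt]; rfl
  rw [hG]
  -- the affine space–time curve and the chain rule
  have hγ : HasDerivAt (fun τ : ℝ => ((τ, yl + (τ * c) • e₀) : ℝ × EuclideanSpace ℝ (Fin 2)))
      ((1 : ℝ), c • e₀) t := by
    refine (hasDerivAt_id t).prodMk ?_
    have h := ((hasDerivAt_id t).mul_const c).smul_const e₀
    simpa using h.const_add yl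
  have hdiff : Differentiable ℝ (Literature.Analysis.FunctionSpaces.Torus.stLift ψ) :=
    hψ.1.differentiable (by simp)
  have hD : HasFDerivAt (Literature.Analysis.FunctionSpaces.Torus.stLift ψ)
      (fderiv ℝ (Literature.Analysis.FunctionSpaces.Torus.stLift ψ) (t, Y)) (t, Y) := (hdiff _).hasFDerivAt
  have hcomp := hD.comp_hasDerivAt t hγ
  -- the value of the derivative
  have hin : HasFDerivAt (fun τ : ℝ => ((τ, Y) : ℝ × EuclideanSpace ℝ (Fin 2)))
      (ContinuousLinearMap.inl ℝ ℝ (EuclideanSpace ℝ (Fin 2))) t := hasFDerivAt_prodMk_left t Y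
  have htime : Literature.Analysis.FunctionSpaces.Torus.timeDeriv ψ t ![y 0 + ((t * c : ℝ) : UnitAddCircle), y 1] =
      fderiv ℝ (Literature.Analysis.FunctionSpaces.Torus.stLift ψ) (t, Y) ((1 : ℝ), (0 : EuclideanSpace ℝ (Fin 2))) := by
    rw [hpt t, show Literature.Analysis.FunctionSpaces.Torus.timeDeriv ψ t
        (Literature.Analysis.FunctionSpaces.Torus.proj (yl + (t * c) • e₀)) =
        Literature.Analysis.FunctionSpaces.Torus.stLift
          (Literature.Analysis.FunctionSpaces.Torus.timeDeriv ψ) (t, Y) from rfl,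
      congrFun (Literature.Analysis.FunctionSpaces.Torus.stLift_timeDeriv ψ) (t, Y)]
    have h2' := hD.comp t hin
    have h2 : HasFDerivAt (fun τ : ℝ => Literature.Analysis.FunctionSpaces.Torus.stLift ψ (τ, Y))
        ((fderiv ℝ (Literature.Analysis.FunctionSpaces.Torus.stLift ψ) (t, Y)).comp
          (ContinuousLinearMap.inl ℝ ℝ (EuclideanSpace ℝ (Fin 2)))) t := h2'
    simp only
    rw [h2.fderiv]
    simp
  have hspace : Literature.Analysis.FunctionSpaces.Torus.partialDeriv 0 (ψ t)
      ![y 0 + ((t * c : ℝ) : UnitAddCircle), y 1] =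
      fderiv ℝ (Literature.Analysis.FunctionSpaces.Torus.stLift ψ) (t, Y) ((0 : ℝ), e₀) := by
    rw [hpt t, Literature.Analysis.FunctionSpaces.Torus.partialDeriv_eq_fderiv_apply
        ((hψ.isSmooth_slice t).isContDiff (by simp)) 0,
      (hψ.isSmoothSpaceTimeOn univ).fderiv_slice_apply (mem_univ t), univ_prod_univ, fderivWithin_univ]
  have hval : fderiv ℝ (Literature.Analysis.FunctionSpaces.Torus.stLift ψ) (t, Y) ((1 : ℝ), c • e₀) =
      Literature.Analysis.FunctionSpaces.Torus.timeDeriv ψ t ![y 0 + ((t * c : ℝ) : UnitAddCircle), y 1] +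
        c * Literature.Analysis.FunctionSpaces.Torus.partialDeriv 0 (ψ t)
          ![y 0 + ((t * c : ℝ) : UnitAddCircle), y 1] := by
    have hsplit : (((1 : ℝ), c • e₀) : ℝ × EuclideanSpace ℝ (Fin 2)) =
        ((1 : ℝ), (0 : EuclideanSpace ℝ (Fin 2))) + c • ((0 : ℝ), e₀) := by simp
    rw [hsplit, map_add, map_smul, smul_eq_mul, htime, hspace]
  exact hcomp.congr_deriv hval

/-- **Integrating along the characteristics** (fundamental theorem of calculus): for `T > 0`
and a space–time test function vanishing near `T`,
`∫₀ᵀ (∂ₜψ + c ∂₁ψ)(t, (y₁ + tc, y₂)) dt = -ψ(0, y)`. [folklore] -/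
theorem setIntegral_deriv_test_comp_skew (hψ : Literature.Analysis.FunctionSpaces.Torus.IsSpaceTimeTest T ψ)
    (hT : 0 < T) (c : ℝ) (y : 𝕋²) :
    ∫ t in Ioo 0 T, (Literature.Analysis.FunctionSpaces.Torus.timeDeriv ψ t
        ![y 0 + ((t * c : ℝ) : UnitAddCircle), y 1] +
      c * Literature.Analysis.FunctionSpaces.Torus.partialDeriv 0 (ψ t)
        ![y 0 + ((t * c : ℝ) : UnitAddCircle), y 1]) = -ψ 0 y := by
  have hcont : Continuous fun t : ℝ => Literature.Analysis.FunctionSpaces.Torus.timeDeriv ψ t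
        ![y 0 + ((t * c : ℝ) : UnitAddCircle), y 1] +
      c * Literature.Analysis.FunctionSpaces.Torus.partialDeriv 0 (ψ t)
        ![y 0 + ((t * c : ℝ) : UnitAddCircle), y 1] := by
    have hq : Continuous fun t : ℝ => (![y 0 + ((t * c : ℝ) : UnitAddCircle), y 1] : 𝕋²) := by
      refine continuous_pi fun i => ?_
      fin_cases i
      · show Continuous fun t : ℝ => y 0 + ((t * c : ℝ) : UnitAddCircle)
        exact continuous_const.add ((AddCircle.continuous_mk' _).comp (continuous_id.mul continuous_const))
      · exact continuous_const
    exact (hψ.continuous_uncurry_timeDeriv.comp (continuous_id.prodMk hq)).add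
      (continuous_const.mul ((hψ.continuous_uncurry_partialDeriv 0).comp (continuous_id.prodMk hq)))
  rw [← integral_Ioc_eq_integral_Ioo, ← intervalIntegral.integral_of_le hT.le,
    intervalIntegral.integral_eq_sub_of_hasDerivAt (fun t _ => hasDerivAt_test_comp_skew hψ c y t)
      (hcont.intervalIntegrable _ _)]
  obtain ⟨T', hT'T, hT'⟩ := hψ.2
  rw [hT' T hT'T.le]
  simp [vec2_eta]

end Characteristics

/-! ## The weak formulation for the shear transport (measurable representative) -/

section WeakEq

variable {T : ℝ} {v : UnitAddCircle → ℝ} {w₀ : 𝕋² → ℝ}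

/-- The transport pairing of the shear velocity with a gradient: `⟪(v(x₂), 0), ∇θ⟫ = v(x₂) ∂₁θ`. [folklore] -/
theorem inner_shearVelocity_gradient (v : UnitAddCircle → ℝ) {θ : 𝕋² → ℝ}
    (hθ : Literature.Analysis.FunctionSpaces.Torus.IsContDiff 1 θ) (t : ℝ) (x : 𝕋²) :
    ⟪shearVelocity v t x, Literature.Analysis.FunctionSpaces.Torus.gradient θ x⟫ =
      v (x 1) * Literature.Analysis.FunctionSpaces.Torus.partialDeriv 0 θ x := by
  rw [Literature.Analysis.FunctionSpaces.Torus.inner_gradient_eq_sum_mul_partialDeriv hθ, Fin.sum_univ_two]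
  simp [shearVelocity]

/-- **The slice identity**: for each `t`, pairing the shear transport with
`∂ₜψ + (v(x₂),0)·∇ψ` is pairing the datum with the derivative of `ψ` along the characteristics,
`∫ w(t) (∂ₜψ + v ∂₁ψ) dx = ∫ w₀(y) (d/dt) ψ(t, (y₁ + t v(y₂), y₂)) dy`. [folklore] -/
theorem integral_shearTransport_mul_transport (hv : Measurable v) (w₀ : 𝕋² → ℝ)
    {ψ : ℝ → 𝕋² → ℝ} (hψ : Literature.Analysis.FunctionSpaces.Torus.IsSpaceTimeTest T ψ) (t : ℝ) :
    ∫ x, shearTransport v w₀ t x *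
        (Literature.Analysis.FunctionSpaces.Torus.timeDeriv ψ t x +
          ⟪shearVelocity v t x, Literature.Analysis.FunctionSpaces.Torus.gradient (ψ t) x⟫ +
          0 * Literature.Analysis.FunctionSpaces.Torus.laplacian (ψ t) x) =
      ∫ y, w₀ y * (Literature.Analysis.FunctionSpaces.Torus.timeDeriv ψ t
          ![y 0 + ((t * v (y 1) : ℝ) : UnitAddCircle), y 1] +
        v (y 1) * Literature.Analysis.FunctionSpaces.Torus.partialDeriv 0 (ψ t)
          ![y 0 + ((t * v (y 1) : ℝ) : UnitAddCircle), y 1]) := by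
  have h1 : ∀ x, Literature.Analysis.FunctionSpaces.Torus.timeDeriv ψ t x +
      ⟪shearVelocity v t x, Literature.Analysis.FunctionSpaces.Torus.gradient (ψ t) x⟫ +
      0 * Literature.Analysis.FunctionSpaces.Torus.laplacian (ψ t) x =
      Literature.Analysis.FunctionSpaces.Torus.timeDeriv ψ t x +
        v (x 1) * Literature.Analysis.FunctionSpaces.Torus.partialDeriv 0 (ψ t) x := fun x => by
    rw [inner_shearVelocity_gradient v ((hψ.isSmooth_slice t).isContDiff (by simp)), zero_mul, add_zero]
  simp_rw [h1]
  rw [integral_shearTransport_mul hv w₀ _ t]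
  refine integral_congr_ae (Eventually.of_forall fun y => ?_)
  simp

/-- **The shear transport satisfies the weak formulation of `∂ₜw + v(x₂)∂₁w = 0` with datum
`w₀`** (Bardos–Titi–Wiedemann 2012, Lemma 4; Bardos–Titi 2010, Thm. 2): for a measurable
`v ∈ L²(T)`, `w₀ ∈ L²(T²)`, `T > 0` and every space–time test function `ψ` on `T² × [0,T)`,
`∫₀ᵀ∫ w (∂ₜψ + (v,0)·∇ψ + 0·Δψ) + ∫ w₀ ψ(0) = 0`. Proof: slice by slice the pairing is
`∫ w₀(y) (d/dt)ψ(t, y₁ + tv(y₂), y₂) dy` (`integral_shearTransport_mul_transport`); Fubini and the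
fundamental theorem of calculus along the characteristics
(`setIntegral_deriv_test_comp_skew`) give `-∫ w₀ ψ(0)`. [cite: BardosTiti2010, Thm. 2] -/
theorem shearTransport_weak_eq (hv : Measurable v) (hv2 : MemLp v 2 volume) (hw₀ : MemLp w₀ 2 volume)
    (hT : 0 < T) {ψ : ℝ → 𝕋² → ℝ} (hψ : Literature.Analysis.FunctionSpaces.Torus.IsSpaceTimeTest T ψ) :
    (∫ t in Ioo 0 T, ∫ x, shearTransport v w₀ t x *
        (Literature.Analysis.FunctionSpaces.Torus.timeDeriv ψ t x +
          ⟪shearVelocity v t x, Literature.Analysis.FunctionSpaces.Torus.gradient (ψ t) x⟫ +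
          0 * Literature.Analysis.FunctionSpaces.Torus.laplacian (ψ t) x)) +
      ∫ x, w₀ x * ψ 0 x = 0 := by
  -- the derivative along the characteristics, as a function of `(t, y)`
  set D : ℝ → 𝕋² → ℝ := fun t y =>
    Literature.Analysis.FunctionSpaces.Torus.timeDeriv ψ t ![y 0 + ((t * v (y 1) : ℝ) : UnitAddCircle), y 1] +
      v (y 1) * Literature.Analysis.FunctionSpaces.Torus.partialDeriv 0 (ψ t)
        ![y 0 + ((t * v (y 1) : ℝ) : UnitAddCircle), y 1] with hD
  simp_rw [integral_shearTransport_mul_transport hv w₀ hψ]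
  -- integrability of `w₀(y) D(t,y)` on `(0,T) × T²`
  obtain ⟨K₁, hK₁⟩ := Literature.Analysis.FunctionSpaces.Torus.exists_norm_le_of_continuousOn_of_isCompact
    (S := univ) hψ.timeDeriv.1.continuous.continuousOn isCompact_Icc (subset_univ (Icc (0 : ℝ) T))
  obtain ⟨K₂, hK₂⟩ := Literature.Analysis.FunctionSpaces.Torus.exists_norm_le_of_continuousOn_of_isCompact
    (S := univ) ((hψ.isSmoothSpaceTimeOn univ).partialDeriv uniqueDiffOn_univ 0).continuousOn_stLift
    isCompact_Icc (subset_univ (Icc (0 : ℝ) T))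
  have hv1 : MemLp (fun y : 𝕋² => v (y 1)) 2 volume :=
    hv2.comp_measurePreserving (measurePreserving_eval (fun _ : Fin 2 => (volume : Measure UnitAddCircle)) 1)
  set B : 𝕋² → ℝ := fun y => |w₀ y| * (K₁ + |v (y 1)| * K₂) with hB
  have hBint : Integrable B volume := by
    have h1 : Integrable (fun y => |w₀ y| * K₁) volume :=
      ((hw₀.integrable one_le_two).abs).mul_const _
    have h2 : Integrable (fun y => |w₀ y| * |v (y 1)|) volume := by
      have := hw₀.abs.integrable_mul hv1.abs
      simpa [Pi.mul_def] using this
    have h3 := h2.mul_const K₂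
    have : B = fun y => |w₀ y| * K₁ + |w₀ y| * |v (y 1)| * K₂ := by
      funext y; simp only [hB]; ring
    rw [this]
    exact h1.add h3
  -- joint measurability of `D` through a continuous kernel
  have hKc : Continuous fun p : ℝ × 𝕋² × ℝ =>
      Literature.Analysis.FunctionSpaces.Torus.timeDeriv ψ p.1 ![p.2.1 0 + ((p.1 * p.2.2 : ℝ) : UnitAddCircle), p.2.1 1] +
        p.2.2 * Literature.Analysis.FunctionSpaces.Torus.partialDeriv 0 (ψ p.1)
          ![p.2.1 0 + ((p.1 * p.2.2 : ℝ) : UnitAddCircle), p.2.1 1] := by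
    have hq : Continuous fun p : ℝ × 𝕋² × ℝ =>
        (![p.2.1 0 + ((p.1 * p.2.2 : ℝ) : UnitAddCircle), p.2.1 1] : 𝕋²) := by
      refine continuous_pi fun i => ?_
      fin_cases i
      · show Continuous fun p : ℝ × 𝕋² × ℝ => p.2.1 0 + ((p.1 * p.2.2 : ℝ) : UnitAddCircle)
        exact ((continuous_apply 0).comp (continuous_fst.comp continuous_snd)).add
          ((AddCircle.continuous_mk' _).comp (continuous_fst.mul (continuous_snd.comp continuous_snd)))
      · show Continuous fun p : ℝ × 𝕋² × ℝ => p.2.1 1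
        exact (continuous_apply 1).comp (continuous_fst.comp continuous_snd)
    exact (hψ.continuous_uncurry_timeDeriv.comp (continuous_fst.prodMk hq)).add
      ((continuous_snd.comp continuous_snd).mul
        ((hψ.continuous_uncurry_partialDeriv 0).comp (continuous_fst.prodMk hq)))
  have hDm : AEStronglyMeasurable (uncurry fun t y => w₀ y * D t y)
      (((volume : Measure ℝ).restrict (Ioo 0 T)).prod (volume : Measure 𝕋²)) := by
    have hw : AEStronglyMeasurable (fun z : ℝ × 𝕋² => w₀ z.2)
        (((volume : Measure ℝ).restrict (Ioo 0 T)).prod (volume : Measure 𝕋²)) := hw₀.1.comp_snd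
    have hinner : Measurable fun z : ℝ × 𝕋² => (z.1, z.2, v (z.2 1)) :=
      measurable_fst.prodMk (measurable_snd.prodMk (hv.comp ((measurable_pi_apply 1).comp measurable_snd)))
    have hD' : AEStronglyMeasurable (fun z : ℝ × 𝕋² => D z.1 z.2)
        (((volume : Measure ℝ).restrict (Ioo 0 T)).prod (volume : Measure 𝕋²)) :=
      (hKc.measurable.comp hinner).aestronglyMeasurable
    exact hw.mul hD'
  have hDint : Integrable (uncurry fun t y => w₀ y * D t y)
      (((volume : Measure ℝ).restrict (Ioo 0 T)).prod (volume : Measure 𝕋²)) := by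
    have hBprod : Integrable (fun z : ℝ × 𝕋² => (1 : ℝ) * B z.2)
        (((volume : Measure ℝ).restrict (Ioo 0 T)).prod (volume : Measure 𝕋²)) :=
      (integrable_const (1 : ℝ)).mul_prod hBint
    refine hBprod.mono' hDm ?_
    have hae : ∀ᵐ z ∂(((volume : Measure ℝ).restrict (Ioo 0 T)).prod (volume : Measure 𝕋²)), z.1 ∈ Ioo 0 T :=
      (Measure.quasiMeasurePreserving_fst (μ := (volume : Measure ℝ).restrict (Ioo 0 T))
        (ν := (volume : Measure 𝕋²))).ae (ae_restrict_mem measurableSet_Ioo)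
    filter_upwards [hae] with z hz
    have ht : z.1 ∈ Icc 0 T := Ioo_subset_Icc_self hz
    rw [one_mul, Real.norm_eq_abs]
    change |w₀ z.2 * D z.1 z.2| ≤ B z.2
    rw [abs_mul, hB]
    refine mul_le_mul_of_nonneg_left ?_ (abs_nonneg _)
    refine (abs_add_le _ _).trans (add_le_add (Real.norm_eq_abs _ ▸ hK₁ _ ht _) ?_)
    rw [abs_mul]
    exact mul_le_mul_of_nonneg_left (Real.norm_eq_abs _ ▸ hK₂ _ ht _) (abs_nonneg _)
  -- Fubini, then the fundamental theorem of calculus along the characteristics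
  rw [integral_integral_swap hDint]
  have hinner : ∀ y, ∫ t in Ioo 0 T, w₀ y * D t y = w₀ y * (-ψ 0 y) := fun y => by
    rw [integral_const_mul, hD]
    simp only
    rw [setIntegral_deriv_test_comp_skew hψ hT (v (y 1)) y]
  simp_rw [hinner, mul_neg, integral_neg]
  exact neg_add_cancel _

end WeakEq

/-! ## The shear transport is a weak solution (measurable representative) -/

section WeakSolution

variable {T : ℝ} {v : UnitAddCircle → ℝ} {w₀ : 𝕋² → ℝ}

/-- The planar embedding `c ↦ (c, 0)` of `ℝ` into `ℝ²` is continuous. [folklore] -/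
theorem continuous_vec2_zero : Continuous fun c : ℝ => (!₂[c, 0] : EuclideanSpace ℝ (Fin 2)) := by
  refine (PiLp.continuous_toLp 2 _).comp (continuous_pi fun i => ?_)
  fin_cases i
  · exact continuous_id
  · exact continuous_const

/-- `‖(a, 0)‖ₑ = ‖a‖ₑ` in `ℝ²`. [folklore] -/
theorem enorm_vec2_zero (a : ℝ) : ‖(!₂[a, 0] : EuclideanSpace ℝ (Fin 2))‖ₑ = ‖a‖ₑ := by
  rw [← ofReal_norm, ← ofReal_norm, EuclideanSpace.norm_eq, Fin.sum_univ_two]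
  simp [Real.sqrt_sq_eq_abs]

/-- The space–time skew map `(t, x) ↦ (t, (x₁ - t v(x₂), x₂))` preserves `(vol|_(0,T)) ⊗ vol`
(Mathlib's `MeasurePreserving.skew_product`, each slice being a measure-preserving skew
translation). [folklore] -/
theorem measurePreserving_spaceTime_skew (hv : Measurable v) (μ : Measure ℝ) [SFinite μ] :
    MeasurePreserving (fun z : ℝ × 𝕋² =>
      (z.1, (![z.2 0 + -(((z.1 * v (z.2 1) : ℝ)) : UnitAddCircle), z.2 1] : 𝕋²)))
      (μ.prod (volume : Measure 𝕋²)) (μ.prod (volume : Measure 𝕋²)) := by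
  refine (MeasurePreserving.id μ).skew_product
    (g := fun (t : ℝ) (x : 𝕋²) => (![x 0 + -(((t * v (x 1) : ℝ)) : UnitAddCircle), x 1] : 𝕋²)) ?_
    (ae_of_all _ fun t => (measurePreserving_skew (measurable_coe_mul hv t).2).map_eq)
  refine measurable_pi_lambda _ fun i => ?_
  fin_cases i
  · show Measurable fun z : ℝ × 𝕋² => z.2 0 + -(((z.1 * v (z.2 1) : ℝ)) : UnitAddCircle)
    have h1 : Measurable fun z : ℝ × 𝕋² => (((z.1 * v (z.2 1) : ℝ)) : UnitAddCircle) :=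
      AddCircle.measurable_mk'.comp (measurable_fst.mul (hv.comp ((measurable_pi_apply 1).comp measurable_snd)))
    exact ((measurable_pi_apply 0).comp measurable_snd).add h1.neg
  · show Measurable fun z : ℝ × 𝕋² => z.2 1
    exact (measurable_pi_apply 1).comp measurable_snd

/-- Joint measurability of the shear transport on `(0,T) × T²`. [folklore] -/
theorem aestronglyMeasurable_uncurry_shearTransport (hv : Measurable v) (hw₀ : AEStronglyMeasurable w₀ volume)
    (T : ℝ) :
    AEStronglyMeasurable (uncurry (shearTransport v w₀))
      (((volume : Measure ℝ).restrict (Ioo 0 T)).prod (volume : Measure 𝕋²)) := by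
  have hΞ := measurePreserving_spaceTime_skew hv ((volume : Measure ℝ).restrict (Ioo 0 T))
  have hq : Measure.QuasiMeasurePreserving (fun z : ℝ × 𝕋² =>
      (![z.2 0 + -(((z.1 * v (z.2 1) : ℝ)) : UnitAddCircle), z.2 1] : 𝕋²))
      (((volume : Measure ℝ).restrict (Ioo 0 T)).prod (volume : Measure 𝕋²)) volume :=
    (Measure.quasiMeasurePreserving_snd (μ := (volume : Measure ℝ).restrict (Ioo 0 T))
      (ν := (volume : Measure 𝕋²))).comp hΞ.quasiMeasurePreserving
  refine (hw₀.comp_quasiMeasurePreserving hq).congr (Eventually.of_forall fun z => ?_)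
  obtain ⟨t, x⟩ := z
  simp [shearTransport, sub_eq_add_neg]

/-- Joint measurability of the (time-independent) shear velocity on `(0,T) × T²`. [folklore] -/
theorem aestronglyMeasurable_uncurry_shearVelocity (hv : Measurable v) (μ : Measure ℝ) :
    AEStronglyMeasurable (uncurry (shearVelocity v)) (μ.prod (volume : Measure 𝕋²)) := by
  have h : Measurable fun z : ℝ × 𝕋² => (!₂[v (z.2 1), 0] : EuclideanSpace ℝ (Fin 2)) :=
    continuous_vec2_zero.measurable.comp (hv.comp ((measurable_pi_apply 1).comp measurable_snd))
  exact h.aestronglyMeasurable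

/-- The shear velocity field `(v(x₂), 0)` is weakly divergence free (its only nonzero component
has no Fourier modes with `k₁ ≠ 0`; Robinson–Rodrigo–Sadowski 2016, Lemma 2.3 in the form
`Torus.isWeaklyDivFree_of_sum_mul_mFourierCoeff_eq_zero`). [folklore] -/
theorem isWeaklyDivFree_shearVelocity (hv : MemLp v 2 volume) (t : ℝ) :
    Literature.Analysis.FunctionSpaces.Torus.IsWeaklyDivFree (shearVelocity v t) := by
  classical
  have hv1 : MemLp (fun x : 𝕋² => v (x 1)) 2 volume :=
    hv.comp_measurePreserving (measurePreserving_eval (fun _ : Fin 2 => (volume : Measure UnitAddCircle)) 1)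
  have hmem : MemLp (shearVelocity v t) 2 volume := by
    refine MemLp.of_eval_piLp fun i => ?_
    fin_cases i
    · simpa [shearVelocity] using hv1
    · simp [shearVelocity]
  refine Literature.Analysis.FluidPDE.Torus.isWeaklyDivFree_of_sum_mul_mFourierCoeff_eq_zero hmem fun k => ?_
  have hint : Integrable (Literature.Analysis.FunctionSpaces.EuclideanSpace.complexify ∘ shearVelocity v t) volume :=
    Literature.Analysis.FunctionSpaces.EuclideanSpace.complexify.toContinuousLinearMap.integrable_comp
      (hmem.integrable one_le_two)
  have hc0 : (fun x : 𝕋² => (Literature.Analysis.FunctionSpaces.EuclideanSpace.complexify ∘ shearVelocity v t) x 0) =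
      fun x => ((v (x 1) : ℝ) : ℂ) := by
    funext x; simp [shearVelocity]
  have hc1 : (fun x : 𝕋² => (Literature.Analysis.FunctionSpaces.EuclideanSpace.complexify ∘ shearVelocity v t) x 1) =
      fun _ => (0 : ℂ) := by
    funext x; simp [shearVelocity]
  have hz0 : (k 0 : ℂ) * mFourierCoeff (fun x : 𝕋² => ((v (x 1) : ℝ) : ℂ)) k = 0 := by
    by_cases hk : k 0 = 0
    · simp [hk]
    · rw [Literature.Analysis.FunctionSpaces.Torus.mFourierCoeff_eq_zero_of_forall_add_single (i := 0)
        (fun s x => by simp) hk, mul_zero]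
  rw [Fin.sum_univ_two, Literature.Analysis.FunctionSpaces.Torus.mFourierCoeff_apply_euclidean hint,
    Literature.Analysis.FunctionSpaces.Torus.mFourierCoeff_apply_euclidean hint, hc0, hc1, hz0]
  simp [mFourierCoeff]

/-- **The shear transport is a weak solution of `∂ₜw + v(x₂)∂₁w = 0` with datum `w₀`, in the
class `L^∞(0,T;L²(T²))`** (Bardos–Titi–Wiedemann 2012, Lemma 4, existence; Bardos–Titi 2010,
Thm. 2) — here for a *measurable* `v ∈ L²(T)`; the general case follows by changing `v` on a
null set (`isWeakScalarTransportOn_shearTransport`). All clauses of the accepted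
`Torus.IsWeakScalarTransportOn`: measurability through the measure-preserving space–time skew
map, the `L^∞_t L²_x` bound `∫ |w(t)|² = ∫ |w₀|²`, `u ∈ L¹_t L²_x` and `u w ∈ L¹` by
Cauchy–Schwarz, weak incompressibility of `(v(x₂),0)`, and the weak identity
`shearTransport_weak_eq`. [cite: BardosTitiWiedemann2012, Lemma 4] -/
theorem isWeakScalarTransportOn_shearTransport_of_measurable (hv : Measurable v) (hv2 : MemLp v 2 volume)
    (hw₀ : MemLp w₀ 2 volume) (hT : 0 < T) :
    Literature.Analysis.FluidPDE.Torus.IsWeakScalarTransportOn T 0 (shearVelocity v) w₀ (shearTransport v w₀) := by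
  have hv1 : MemLp (fun x : 𝕋² => v (x 1)) 2 volume :=
    hv2.comp_measurePreserving (measurePreserving_eval (fun _ : Fin 2 => (volume : Measure UnitAddCircle)) 1)
  -- the two constant slice energies
  have hEw : ∫⁻ x, ‖w₀ x‖ₑ ^ 2 < ⊤ := by
    rw [← Literature.Analysis.FunctionSpaces.eLpNorm_two_pow_two_eq_lintegral]
    exact ENNReal.pow_lt_top hw₀.eLpNorm_lt_top
  have hEv : ∫⁻ x : 𝕋², ‖v (x 1)‖ₑ ^ 2 < ⊤ := by
    rw [← Literature.Analysis.FunctionSpaces.eLpNorm_two_pow_two_eq_lintegral]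
    exact ENNReal.pow_lt_top hv1.eLpNorm_lt_top
  have hu_sq : ∀ t (x : 𝕋²), ‖shearVelocity v t x‖ₑ ^ 2 = ‖v (x 1)‖ₑ ^ 2 := fun t x => by
    rw [shearVelocity, enorm_vec2_zero]
  have hvol : volume (Ioo (0 : ℝ) T) < ⊤ := measure_Ioo_lt_top
  refine ⟨?_, ?_, ?_, ?_, ?_, Eventually.of_forall fun t => isWeaklyDivFree_shearVelocity hv2 t,
    fun ψ hψ => shearTransport_weak_eq hv hv2 hw₀ hT hψ⟩
  · exact Literature.Analysis.FunctionSpaces.Torus.aestronglyMeasurable_stLift_of_uncurry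
      (aestronglyMeasurable_uncurry_shearTransport hv hw₀.1 T)
  · exact Literature.Analysis.FunctionSpaces.Torus.aestronglyMeasurable_stLift_of_uncurry
      (aestronglyMeasurable_uncurry_shearVelocity hv _)
  · refine ⟨(∫⁻ x, ‖w₀ x‖ₑ ^ 2).toNNReal, Eventually.of_forall fun t => ?_⟩
    rw [lintegral_enorm_sq_shearTransport hv w₀ t, ENNReal.coe_toNNReal hEw.ne]
  · calc ∫⁻ t in Ioo 0 T, (∫⁻ x, ‖shearVelocity v t x‖ₑ ^ 2) ^ (1 / 2 : ℝ)
        = ∫⁻ _ in Ioo (0 : ℝ) T, (∫⁻ x : 𝕋², ‖v (x 1)‖ₑ ^ 2) ^ (1 / 2 : ℝ) := by simp_rw [hu_sq]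
      _ < ⊤ := by
          rw [lintegral_const, Measure.restrict_apply_univ]
          exact ENNReal.mul_lt_top (ENNReal.rpow_lt_top_of_nonneg (by norm_num) hEv.ne) hvol
  · have hslice : ∀ t, ∫⁻ x, ‖shearVelocity v t x‖ₑ * ‖shearTransport v w₀ t x‖ₑ ≤
        (∫⁻ x : 𝕋², ‖v (x 1)‖ₑ ^ 2) ^ (1 / 2 : ℝ) * (∫⁻ x, ‖w₀ x‖ₑ ^ 2) ^ (1 / 2 : ℝ) := by
      intro t
      have hf' : Measurable fun x : 𝕋² => shearVelocity v t x :=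
        continuous_vec2_zero.measurable.comp (hv.comp (measurable_pi_apply 1))
      have hf : AEMeasurable (fun x => ‖shearVelocity v t x‖ₑ) volume := hf'.enorm.aemeasurable
      have hg : AEMeasurable (fun x => ‖shearTransport v w₀ t x‖ₑ) volume :=
        (memLp_shearTransport hv hw₀ t).1.aemeasurable.enorm
      have h := ENNReal.lintegral_mul_le_Lp_mul_Lq volume Real.HolderConjugate.two_two hf hg
      simp only [Pi.mul_apply, one_div] at h
      rw [← lintegral_enorm_sq_shearTransport hv w₀ t]
      simp_rw [← hu_sq t]
      convert h using 3 <;> simp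
    calc ∫⁻ t in Ioo 0 T, ∫⁻ x, ‖shearVelocity v t x‖ₑ * ‖shearTransport v w₀ t x‖ₑ
        ≤ ∫⁻ _ in Ioo (0 : ℝ) T, (∫⁻ x : 𝕋², ‖v (x 1)‖ₑ ^ 2) ^ (1 / 2 : ℝ) * (∫⁻ x, ‖w₀ x‖ₑ ^ 2) ^ (1 / 2 : ℝ) :=
          lintegral_mono fun t => hslice t
      _ < ⊤ := by
          rw [lintegral_const, Measure.restrict_apply_univ]
          exact ENNReal.mul_lt_top (ENNReal.mul_lt_top (ENNReal.rpow_lt_top_of_nonneg (by norm_num) hEv.ne)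
            (ENNReal.rpow_lt_top_of_nonneg (by norm_num) hEw.ne)) hvol

end WeakSolution

/-! ## Weak continuity of the shear transport -/

section WeakContinuity

variable {v : UnitAddCircle → ℝ} {w₀ : 𝕋² → ℝ}

/-- Cauchy–Schwarz: `|∫ A r| ≤ (‖A‖_{L²} ‖r‖_{L²}).toReal` for `A, r ∈ L²`. [folklore] -/
theorem abs_integral_mul_le_toReal {A r : 𝕋² → ℝ} (hA : MemLp A 2 volume) (hr : MemLp r 2 volume) :
    |∫ x, A x * r x| ≤ (eLpNorm A 2 volume * eLpNorm r 2 volume).toReal := by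
  have hfin : eLpNorm A 2 volume * eLpNorm r 2 volume ≠ ⊤ :=
    ENNReal.mul_ne_top hA.eLpNorm_ne_top hr.eLpNorm_ne_top
  have h1 := Literature.Analysis.FluidPDE.Torus.ofReal_integral_mul_le_eLpNorm_mul hA.1 hr.1
  have h2 := Literature.Analysis.FluidPDE.Torus.ofReal_integral_mul_le_eLpNorm_mul hA.1 hr.1.neg
  rw [eLpNorm_neg] at h2
  have h2' : ENNReal.ofReal (-∫ x, A x * r x) ≤ eLpNorm A 2 volume * eLpNorm r 2 volume := by
    rw [← integral_neg]
    simpa [mul_neg] using h2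
  rw [abs_le]
  constructor
  · have := (ENNReal.ofReal_le_iff_le_toReal hfin).1 h2'
    linarith
  · exact (ENNReal.ofReal_le_iff_le_toReal hfin).1 h1

/-- **Weak continuity of the shear transport in `L²`** (Bardos–Titi–Wiedemann 2012, Lemma 4:
`w ∈ C([0,T];L²_w(T²))`): for measurable `v`, `w₀ ∈ L²` and `g ∈ L²`,
`t ↦ ∫ w₀(x₁ - t v(x₂), x₂) g(x) dx = ∫ w₀(y) g(y₁ + t v(y₂), y₂) dy` is continuous: for
continuous `g` by dominated convergence, in general by `L²`-approximation of `g` by continuous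
functions, the error being `≤ ‖w₀‖₂ ‖g - g̃‖₂` uniformly in `t` (the skew translations preserve
the `L²` norm). [cite: BardosTitiWiedemann2012, Lemma 4] -/
theorem continuous_integral_shearTransport_mul (hv : Measurable v) (hw₀ : MemLp w₀ 2 volume)
    {g : 𝕋² → ℝ} (hg : MemLp g 2 volume) :
    Continuous fun t => ∫ x, shearTransport v w₀ t x * g x := by
  simp_rw [integral_shearTransport_mul hv]
  -- the moving point and the composed functions
  have hqc : ∀ y : 𝕋², Continuous fun t : ℝ => (![y 0 + ((t * v (y 1) : ℝ) : UnitAddCircle), y 1] : 𝕋²) := by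
    intro y
    refine continuous_pi fun i => ?_
    fin_cases i
    · show Continuous fun t : ℝ => y 0 + ((t * v (y 1) : ℝ) : UnitAddCircle)
      exact continuous_const.add ((AddCircle.continuous_mk' _).comp (continuous_id.mul continuous_const))
    · exact continuous_const
  have hmp : ∀ t : ℝ, MeasurePreserving (fun y : 𝕋² => (![y 0 + ((t * v (y 1) : ℝ) : UnitAddCircle), y 1] : 𝕋²))
      volume volume := fun t => measurePreserving_skew (measurable_coe_mul hv t).1
  have hcomp : ∀ {h : 𝕋² → ℝ}, MemLp h 2 volume → ∀ t : ℝ,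
      MemLp (fun y : 𝕋² => h ![y 0 + ((t * v (y 1) : ℝ) : UnitAddCircle), y 1]) 2 volume ∧
      eLpNorm (fun y : 𝕋² => h ![y 0 + ((t * v (y 1) : ℝ) : UnitAddCircle), y 1]) 2 volume = eLpNorm h 2 volume :=
    fun hh t => ⟨hh.comp_measurePreserving (hmp t), eLpNorm_comp_measurePreserving hh.1 (hmp t)⟩
  -- uniform approximation by the pairings with continuous `g̃`
  refine continuous_of_uniform_approx_of_continuous fun u hu => ?_
  obtain ⟨ε, hε, hεu⟩ := Metric.mem_uniformity_dist.1 hu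
  set a : ℝ := (eLpNorm w₀ 2 volume).toReal with ha
  have ha0 : 0 ≤ a := ENNReal.toReal_nonneg
  set δ : ℝ := ε / (2 * (a + 1)) with hδ
  have hδ0 : 0 < δ := div_pos hε (by positivity)
  obtain ⟨gc, hgc, hgcL⟩ := hg.exists_boundedContinuous_eLpNorm_sub_le ENNReal.ofNat_ne_top
    (ENNReal.ofReal_pos.2 hδ0).ne'
  refine ⟨fun t => ∫ y, w₀ y * gc ![y 0 + ((t * v (y 1) : ℝ) : UnitAddCircle), y 1], ?_, fun t => hεu ?_⟩
  · -- continuity for the continuous approximant: dominated convergence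
    refine continuous_of_dominated (bound := fun y => |w₀ y| * ‖gc‖) (fun t => ?_) (fun t => ?_) ?_ ?_
    · exact hw₀.1.mul ((gc.continuous.measurable.comp (hmp t).measurable).aestronglyMeasurable)
    · refine Eventually.of_forall fun y => ?_
      rw [norm_mul, Real.norm_eq_abs]
      exact mul_le_mul_of_nonneg_left (gc.norm_coe_le_norm _) (abs_nonneg _)
    · exact (hw₀.integrable one_le_two).abs.mul_const _
    · exact Eventually.of_forall fun y => continuous_const.mul (gc.continuous.comp (hqc y))
  · -- the uniform error bound `‖w₀‖₂ ‖g - g̃‖₂ < ε`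
    rw [Real.dist_eq]
    have hi1 : Integrable (fun y : 𝕋² => w₀ y * g ![y 0 + ((t * v (y 1) : ℝ) : UnitAddCircle), y 1]) volume :=
      hw₀.integrable_mul (hcomp hg t).1
    have hi2 : Integrable (fun y : 𝕋² => w₀ y * gc ![y 0 + ((t * v (y 1) : ℝ) : UnitAddCircle), y 1]) volume :=
      hw₀.integrable_mul (hcomp hgcL t).1
    rw [← integral_sub hi1 hi2]
    have hsub : (fun y : 𝕋² => w₀ y * g ![y 0 + ((t * v (y 1) : ℝ) : UnitAddCircle), y 1] -
        w₀ y * gc ![y 0 + ((t * v (y 1) : ℝ) : UnitAddCircle), y 1]) =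
        fun y => w₀ y * (g - ⇑gc) ![y 0 + ((t * v (y 1) : ℝ) : UnitAddCircle), y 1] := by
      funext y; simp only [Pi.sub_apply]; ring
    rw [hsub]
    have hd := hcomp (hg.sub hgcL) t
    refine (abs_integral_mul_le_toReal hw₀ hd.1).trans_lt ?_
    rw [hd.2]
    have hfin : eLpNorm w₀ 2 volume * ENNReal.ofReal δ ≠ ⊤ :=
      ENNReal.mul_ne_top hw₀.eLpNorm_ne_top ENNReal.ofReal_ne_top
    calc (eLpNorm w₀ 2 volume * eLpNorm (g - ⇑gc) 2 volume).toReal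
        ≤ (eLpNorm w₀ 2 volume * ENNReal.ofReal δ).toReal :=
          ENNReal.toReal_mono hfin (by gcongr)
      _ = a * δ := by rw [ENNReal.toReal_mul, ENNReal.toReal_ofReal hδ0.le]
      _ ≤ (a + 1) * δ := mul_le_mul_of_nonneg_right (le_add_of_nonneg_right zero_le_one) hδ0.le
      _ = ε / 2 := by rw [hδ]; field_simp
      _ < ε := half_lt_self hε

end WeakContinuity

/-! ## General `v ∈ L²(T)`: change on a null set, and the existence half of Lemma 4 -/

section General

variable {T : ℝ} {v : UnitAddCircle → ℝ} {w₀ : 𝕋² → ℝ}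

/-- Changing `v` on a null set of `T` changes the shear transport and the shear velocity only on
a null set of `T²`, slice by slice. [folklore] -/
theorem shear_ae_congr {v v' : UnitAddCircle → ℝ} (h : v =ᵐ[volume] v') (w₀ : 𝕋² → ℝ) (t : ℝ) :
    ∀ᵐ x : 𝕋² ∂volume, shearTransport v w₀ t x = shearTransport v' w₀ t x ∧
      shearVelocity v t x = shearVelocity v' t x := by
  have hV : ∀ᵐ x : 𝕋² ∂volume, v (x 1) = v' (x 1) :=
    (measurePreserving_eval (fun _ : Fin 2 => (volume : Measure UnitAddCircle)) 1).quasiMeasurePreserving.ae_eq h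
  exact hV.mono fun x hx => by simp [shearTransport, shearVelocity, hx]

/-- The same on `ℝ × T²` for a product measure. [folklore] -/
theorem shear_ae_congr_prod {v v' : UnitAddCircle → ℝ} (h : v =ᵐ[volume] v') (w₀ : 𝕋² → ℝ)
    (μ : Measure ℝ) [SFinite μ] :
    ∀ᵐ z : ℝ × 𝕋² ∂(μ.prod volume), shearTransport v w₀ z.1 z.2 = shearTransport v' w₀ z.1 z.2 ∧
      shearVelocity v z.1 z.2 = shearVelocity v' z.1 z.2 := by
  have hq : Measure.QuasiMeasurePreserving (fun z : ℝ × 𝕋² => z.2 1) (μ.prod volume) volume :=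
    (measurePreserving_eval (fun _ : Fin 2 => (volume : Measure UnitAddCircle)) 1).quasiMeasurePreserving.comp
      (Measure.quasiMeasurePreserving_snd (μ := μ) (ν := (volume : Measure 𝕋²)))
  have hV : ∀ᵐ z : ℝ × 𝕋² ∂(μ.prod volume), v (z.2 1) = v' (z.2 1) := hq.ae_eq h
  exact hV.mono fun z hz => by simp [shearTransport, shearVelocity, hz]

/-- **The shear transport is a weak solution in `L^∞(0,T;L²(T²))` for every `v ∈ L²(T)`,
`w₀ ∈ L²(T²)`** (Bardos–Titi–Wiedemann 2012, Lemma 4, existence; Bardos–Titi 2010, Thm. 2):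
`isWeakScalarTransportOn_shearTransport_of_measurable` for a measurable representative of
`v`, transported back along the null-set changes `shear_ae_congr`, `shear_ae_congr_prod`
(every clause of `Torus.IsWeakScalarTransportOn` is an integral). [cite: BardosTitiWiedemann2012, Lemma 4] -/
theorem isWeakScalarTransportOn_shearTransport (hv : MemLp v 2 volume) (hw₀ : MemLp w₀ 2 volume)
    (hT : 0 < T) :
    Literature.Analysis.FluidPDE.Torus.IsWeakScalarTransportOn T 0 (shearVelocity v) w₀ (shearTransport v w₀) := by
  set v' : UnitAddCircle → ℝ := hv.1.mk v with hv'
  have hv'm : Measurable v' := hv.1.stronglyMeasurable_mk.measurable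
  have hvv' : v =ᵐ[volume] v' := hv.1.ae_eq_mk
  have hv'2 : MemLp v' 2 volume := hv.ae_eq hvv'
  have H := isWeakScalarTransportOn_shearTransport_of_measurable hv'm hv'2 hw₀ hT
  have hae := fun t => shear_ae_congr hvv' w₀ t
  refine ⟨?_, ?_, ?_, ?_, ?_, Eventually.of_forall fun t => isWeaklyDivFree_shearVelocity hv t, fun ψ hψ => ?_⟩
  · refine Literature.Analysis.FunctionSpaces.Torus.aestronglyMeasurable_stLift_of_uncurry ?_
    exact (aestronglyMeasurable_uncurry_shearTransport hv'm hw₀.1 T).congr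
      ((shear_ae_congr_prod hvv' w₀ _).mono fun z hz => hz.1.symm)
  · refine Literature.Analysis.FunctionSpaces.Torus.aestronglyMeasurable_stLift_of_uncurry (S := Ioo 0 T) ?_
    exact (aestronglyMeasurable_uncurry_shearVelocity hv'm _).congr
      ((shear_ae_congr_prod hvv' w₀ _).mono fun z hz => hz.2.symm)
  · obtain ⟨C, hC⟩ := H.ae_lintegral_sq_le
    refine ⟨C, hC.mono fun t ht => ?_⟩
    have hEq : (fun x => ‖shearTransport v w₀ t x‖ₑ ^ 2) =ᵐ[volume]
        fun x => ‖shearTransport v' w₀ t x‖ₑ ^ 2 := (hae t).mono fun x hx => by simp only [hx.1]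
    rwa [lintegral_congr_ae hEq]
  · have h := H.lintegral_velocity_lt_top
    calc ∫⁻ t in Ioo 0 T, (∫⁻ x, ‖shearVelocity v t x‖ₑ ^ 2) ^ (1 / 2 : ℝ)
        = ∫⁻ t in Ioo 0 T, (∫⁻ x, ‖shearVelocity v' t x‖ₑ ^ 2) ^ (1 / 2 : ℝ) := by
          refine lintegral_congr fun t => ?_
          have hEq : (fun x => ‖shearVelocity v t x‖ₑ ^ 2) =ᵐ[volume]
              fun x => ‖shearVelocity v' t x‖ₑ ^ 2 := (hae t).mono fun x hx => by simp only [hx.2]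
          rw [lintegral_congr_ae hEq]
      _ < ⊤ := h
  · have h := H.lintegral_mul_lt_top
    calc ∫⁻ t in Ioo 0 T, ∫⁻ x, ‖shearVelocity v t x‖ₑ * ‖shearTransport v w₀ t x‖ₑ
        = ∫⁻ t in Ioo 0 T, ∫⁻ x, ‖shearVelocity v' t x‖ₑ * ‖shearTransport v' w₀ t x‖ₑ := by
          refine lintegral_congr fun t => ?_
          exact lintegral_congr_ae ((hae t).mono fun x hx => by simp only [hx.1, hx.2])
      _ < ⊤ := h
  · have hw := H.weak_eq ψ hψ
    have hinner : ∀ t, ∫ x, shearTransport v w₀ t x *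
        (Literature.Analysis.FunctionSpaces.Torus.timeDeriv ψ t x +
          ⟪shearVelocity v t x, Literature.Analysis.FunctionSpaces.Torus.gradient (ψ t) x⟫ +
          0 * Literature.Analysis.FunctionSpaces.Torus.laplacian (ψ t) x) =
        ∫ x, shearTransport v' w₀ t x *
        (Literature.Analysis.FunctionSpaces.Torus.timeDeriv ψ t x +
          ⟪shearVelocity v' t x, Literature.Analysis.FunctionSpaces.Torus.gradient (ψ t) x⟫ +
          0 * Literature.Analysis.FunctionSpaces.Torus.laplacian (ψ t) x) := fun t =>
      integral_congr_ae ((hae t).mono fun x hx => by simp only [hx.1, hx.2])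
    simp_rw [hinner]
    exact hw

/-- Slices of the shear transport are in `L²` for every `v ∈ L²(T)`. [cite: BardosTiti2010, Lemma 3] -/
theorem memLp_shearTransport' (hv : MemLp v 2 volume) (hw₀ : MemLp w₀ 2 volume) (t : ℝ) :
    MemLp (shearTransport v w₀ t) 2 volume := by
  have hm : Measurable (hv.1.mk v) := hv.1.stronglyMeasurable_mk.measurable
  exact (memLp_shearTransport hm hw₀ t).ae_eq
    ((shear_ae_congr hv.1.ae_eq_mk w₀ t).mono fun x hx => hx.1.symm)

/-- Weak continuity of the shear transport for every `v ∈ L²(T)`. [cite: BardosTitiWiedemann2012, Lemma 4] -/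
theorem continuous_integral_shearTransport_mul' (hv : MemLp v 2 volume) (hw₀ : MemLp w₀ 2 volume)
    {g : 𝕋² → ℝ} (hg : MemLp g 2 volume) :
    Continuous fun t => ∫ x, shearTransport v w₀ t x * g x := by
  have hm : Measurable (hv.1.mk v) := hv.1.stronglyMeasurable_mk.measurable
  have h := continuous_integral_shearTransport_mul hm hw₀ hg
  have heq : (fun t => ∫ x, shearTransport v w₀ t x * g x) =
      fun t => ∫ x, shearTransport (hv.1.mk v) w₀ t x * g x := by
    funext t
    exact integral_congr_ae ((shear_ae_congr hv.1.ae_eq_mk w₀ t).mono fun x hx => by simp only [hx.1])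
  rw [heq]
  exact h

/-- **Bardos–Titi–Wiedemann 2012, Lemma 4 — the existence half, proved.** For `v ∈ L²(T)`,
`w₀ ∈ L²(T²)` and `T > 0`, the shear transport `w(x,t) = w₀(x₁ - t v(x₂), x₂)` is a weak
solution of `∂ₜw + v(x₂)∂₁w = 0` on `T² × [0,T)` with datum `w₀`, in `C([0,T];L²_w(T²))`:
exactly the first conjunct of `BardosTitiWiedemann2012_lemma4` (Bardos–Titi 2010, Thm. 2, for
the explicit solution). [cite: BardosTitiWiedemann2012, Lemma 4] -/
theorem BardosTitiWiedemann2012_lemma4_exists (v : UnitAddCircle → ℝ) (hv : MemLp v 2 volume)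
    (w₀ : 𝕋² → ℝ) (hw₀ : MemLp w₀ 2 volume) (T : ℝ) (hT : 0 < T) :
    ∃ w : ℝ → 𝕋² → ℝ,
      Literature.Analysis.FluidPDE.Torus.IsWeakScalarTransportOn T 0 (shearVelocity v) w₀ w ∧
      (∀ t ∈ Icc 0 T, MemLp (w t) 2 volume) ∧
      (∀ g : 𝕋² → ℝ, MemLp g 2 volume → ContinuousOn (fun t => ∫ x, w t x * g x) (Icc 0 T)) ∧
      w 0 =ᵐ[volume] w₀ :=
  ⟨shearTransport v w₀, isWeakScalarTransportOn_shearTransport hv hw₀ hT,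
    fun t _ => memLp_shearTransport' hv hw₀ t,
    fun _ hg => (continuous_integral_shearTransport_mul' hv hw₀ hg).continuousOn,
    by rw [shearTransport_zero]⟩

end General

end Literature.Barriers.AnomalousDissipation

end
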